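import Summits.BirchSwinnertonDyer.BirchSwinnertonDyer.Theorems.SignedLowerHalvesSprungLowerHalfAtThreeCMTransferRecords
import HarnessLib

/-!
# Route `SignedLowerHalves`, crux `SprungLowerHalfAtThree` (item stmt-BirchSwinnertonDyer-19003) — the UNIT CASE of the CM-congruence
# transfer line L5-CM on X8: `BSD(E,3)` MODULO the Corpuz–Lei ♯/♭ PRE binder ALONE for the nine remaining small-image (`3Nn`) X8
# cells whose CM partner is `32a2 : y² = x³ − x` or `64a4 : y² = x³ + x` (cell `bsd-ssimc`, seat `bsd-ssimc-k3-c5` gen 4; MEMO-3 §6 (S1))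

HONEST FRAMING: every record is CONDITIONAL on the OPEN binder `CorpuzLei2025_sharpFlatMainConjecture_transfer_OPEN` (UNREFEREED
preprint arXiv:2508.09733, typed `@[conjecture]` in its own file; audit points A-CL♯♭-1…4; referee REPORT-k3c5-2 = PASS on the typing),
on the PUBLISHED named facts `hPR` (Pollack–Rubin 2004), `h5`/`h3` (period units), `hmodE` (modularity), `hmod`, `hGZK`, and on TWO
displayed per-pair data: `h0 : r_an(E) = 0` (Cremona) and the partner's single `L`-VALUE LINE `hL1 : L(E′,1)/Ω_{E′} = 1/8` (`32a2`)
resp. `1/4` (`64a4`) — three-engine values of record (k3-c4 table37 rows `[0,0,0,∓1,0]`, kit j251201; kit j251003; referee j252061).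
From that line the partner's `μ`-node `SignedMuVanishing E′ 3` is a THEOREM (`signedMuVanishing_of_lvalue_three`, Kurihara's unit
case), so NO `μ`-certificate enters: these nine cells sit at «PRE binder alone». The congruences `E[3] ≅ E′[3]` are the UNCONDITIONAL
kernel theorems `threeTorsionIso_c<label>` (`…CMCongruencesA/B.lean`); `ClassX8 E 3` and the partner data (`GoodSS E′ 3`, `a_3(E′) = 0`,
CM) are decided from the integer models (the partner's inside ONE lemma each — nothing already in the tree is restated as a
declaration). All nine cells are ALREADY flag-free per pair by exact 3-descent (`bsdp3_nn<label>`); these records add the SECOND,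
Iwasawa-theoretic road — the ♯/♭ main conjecture with unit content transported from a Pollack–Rubin curve — i.e. the line of
record L5-CM exercised end-to-end on 10/37 partnered cells (with `396704db1`). Nothing is booked; X8 stays CONSTRUCTION-SHAPED;
crux 5 stays OPEN (clause (A) = modularity); BSD is not proved by any of this.

Contents: §1 valuations; §2 the two partners' data; §3 `#Ẽ(𝔽₃) = 1` for the nine cells; §4 the generic unit-case consumer
`X8.bsdp_of_unitCasePartner_of_transfer_OPEN` and the nine records. References: [CorpuzLei2025] Thm. 5.10; [PollackRubin2004] Thm. (p. 448);
[Kurihara2002] Thm. 0.1; [Kobayashi2003] (3.6); [GreenbergVatsal2000] §3 Rem. 3.4; [Fisher2012Hessian] Thm. 13.2, §13; [Sprung2012]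
Main Conj. 7.21; [Cremona2006] Table 1; [SilvermanAEC2009] VII.5, App. C §11. Memo `HOME/bsd-ssimc-k3-c5-MEMO-4.md`.
-/

set_option autoImplicit false
set_option linter.dupNamespace false -- the tree's namespace `Summit.BirchSwinnertonDyer.BirchSwinnertonDyer.Theorems` repeats a component (layout D-0017)

noncomputable section

open scoped Classical MatrixGroups ModularForm

open CongruenceSubgroup WeierstrassCurve Literature.NumberTheory.EllipticCurves
  Literature.NumberTheory.EllipticCurves.ModularForms
  Literature.NumberTheory.EllipticCurves.Rank1Residual
  Literature.NumberTheory.EllipticCurves.Rank1Residual.Typed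
  Summit.BirchSwinnertonDyer.Rank1Residual.Supersingular
  Literature.NumberTheory.EllipticCurves.Rank1Residual.X11RankOneCertificates
  Summit.BirchSwinnertonDyer.BirchSwinnertonDyer.Rank1Residual.IntModel
  Summit.BirchSwinnertonDyer.BirchSwinnertonDyer.Rank1Residual.X11RankOne
  Summit.BirchSwinnertonDyer.Rank1Residual.X11b

namespace Summit.BirchSwinnertonDyer.BirchSwinnertonDyer.Theorems

/-! ### §1. Valuations of the two unit `L`-values -/

/-- `ord₃(1/8) = 0`. [folklore] -/
theorem padicValRat_three_one_div_eight : padicValRat 3 (1 / 8 : ℚ) = 0 := by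
  rw [one_div, padicValRat.inv, neg_eq_zero, show (8 : ℚ) = ((8 : ℕ) : ℚ) by norm_num, padicValRat.of_nat,
    Nat.cast_eq_zero, padicValNat.eq_zero_of_not_dvd (by norm_num)]

/-- `ord₃(1/4) = 0`. [folklore] -/
theorem padicValRat_three_one_div_four : padicValRat 3 (1 / 4 : ℚ) = 0 := by
  rw [one_div, padicValRat.inv, neg_eq_zero, show (4 : ℚ) = ((4 : ℕ) : ℚ) by norm_num, padicValRat.of_nat,
    Nat.cast_eq_zero, padicValNat.eq_zero_of_not_dvd (by norm_num)]
/-! ### §2. Kernel data of the two partners (decided once per partner INSIDE one lemma; the standalone point-count /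
`Δ ≠ 0` / minimality / CM lemmas for these two literal models already exist in the tree — k3-c4's `card_cm32a2_3`,
`hasCM_cm32a2`, `Literature.….isElliptic_caseI_example`, `tamePinch_isGloballyMinimal_thirtyTwoA2`, … — and are NOT
restated: the records quantify over a globally minimal elliptic `W′` EQUAL to the model) -/

/-- **Partner `32a2 : y² = x³ − x`**: good supersingular at `3` with `a_3 = 0` (`#Ẽ′(𝔽₃) = 4`) and CM (`j = 1728`,
`j_shortCM_eq`). [cite: SilvermanAEC2009, VII.5 Prop. 5.1(a) and App. C §11, Example 11.3.1] -/
theorem X8.partnerData_cm32a2 (W' : WeierstrassCurve ℚ) [W'.IsElliptic] [W'.IsGloballyMinimal]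
    (hW' : W' = ⟨0, 0, 0, -1, 0⟩) : GoodSS W' 3 ∧ W'.frobeniusTrace 3 = 0 ∧ W'.HasCM := by
  haveI : Fact (Nat.Prime 3) := ⟨by norm_num⟩
  -- the point count `#Ẽ′(𝔽₃) = 4` is k3-c4's tree lemma `card_cm32a2_3` (`…SmallImageCMTransferRecordsA`); it is
  -- re-derived INSIDE this proof (not restated as a declaration) to keep this file's imports on the L5-CM chain
  have hcard : Nat.card (((⟨0, 0, 0, -1, 0⟩ : WeierstrassCurve ℤ).map
      (Int.castRingHom (ZMod 3))).toAffine.Point) = 4 := by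
    rw [@WeierstrassCurve.natCard_point_eq_one_add_card (ZMod 3) (@ZMod.instField 3 ⟨by norm_num⟩) _ _ _
      (by decide +kernel), @card_sol_eq_sum_euler (ZMod 3) (@ZMod.instField 3 ⟨by norm_num⟩) _ _
      (by rw [ZMod.ringChar_zmod_n]; decide), ZMod.card]
    decide +kernel
  have hIW' : integralModelInt W' = ⟨0, 0, 0, -1, 0⟩ :=
    integralModelInt_eq_of_map_eq _ (by rw [hW']; ext <;> simp [WeierstrassCurve.map])
  refine ⟨goodSS_of_intModel 3 hIW' (by rw [intCurve_Δ 0 0 0 (-1) 0]; decide +kernel) hcard (by decide), ?_,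
    hasCM_of_j_eq_1728 W' (by subst hW'; exact j_shortCM_eq (-1))⟩
  rw [frobeniusTrace_eq hIW' hcard]; norm_num

/-- **Partner `64a4 : y² = x³ + x`**: good supersingular at `3` with `a_3 = 0` (`#Ẽ′(𝔽₃) = 4`, kernel count inside the
proof) and CM (`j = 1728`, `j_shortCM_eq`). [cite: SilvermanAEC2009, VII.5 Prop. 5.1(a) and App. C §11, Example 11.3.1] -/
theorem X8.partnerData_cm64a4 (W' : WeierstrassCurve ℚ) [W'.IsElliptic] [W'.IsGloballyMinimal]
    (hW' : W' = ⟨0, 0, 0, 1, 0⟩) : GoodSS W' 3 ∧ W'.frobeniusTrace 3 = 0 ∧ W'.HasCM := by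
  haveI : Fact (Nat.Prime 3) := ⟨by norm_num⟩
  have hcard : Nat.card (((⟨0, 0, 0, 1, 0⟩ : WeierstrassCurve ℤ).map
      (Int.castRingHom (ZMod 3))).toAffine.Point) = 4 := by
    rw [@WeierstrassCurve.natCard_point_eq_one_add_card (ZMod 3) (@ZMod.instField 3 ⟨by norm_num⟩) _ _ _
      (by decide +kernel), @card_sol_eq_sum_euler (ZMod 3) (@ZMod.instField 3 ⟨by norm_num⟩) _ _
      (by rw [ZMod.ringChar_zmod_n]; decide), ZMod.card]
    decide +kernel
  have hIW' : integralModelInt W' = ⟨0, 0, 0, 1, 0⟩ :=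
    integralModelInt_eq_of_map_eq _ (by rw [hW']; ext <;> simp [WeierstrassCurve.map])
  refine ⟨goodSS_of_intModel 3 hIW' (by rw [intCurve_Δ 0 0 0 1 0]; decide +kernel) hcard (by decide), ?_,
    hasCM_of_j_eq_1728 W' (by subst hW'; exact j_shortCM_eq 1)⟩
  rw [frobeniusTrace_eq hIW' hcard]; norm_num

/-! ### §3. `#Ẽ(𝔽₃) = 1` (`a_3 = 3`) for the nine cells (kernel point counts on the Cremona models) -/

/-- `#Ẽ(𝔽₃) = 1` for `46112f1 = [0,0,0,-196696,-34134640]` (`a_3 = 3`). [cite: Cremona2006, Table 1 (Cremona label 46112f1)] -/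
theorem card_c46112f1_3 :
    Nat.card (((⟨0, 0, 0, -196696, -34134640⟩ : WeierstrassCurve ℤ).map
      (Int.castRingHom (ZMod 3))).toAffine.Point) = 1 := by
  rw [@WeierstrassCurve.natCard_point_eq_one_add_card (ZMod 3) (@ZMod.instField 3 ⟨by norm_num⟩) _ _ _ (by decide +kernel),
    @card_sol_eq_sum_euler (ZMod 3) (@ZMod.instField 3 ⟨by norm_num⟩) _ _ (by rw [ZMod.ringChar_zmod_n]; decide), ZMod.card]
  decide +kernel

/-- `#Ẽ(𝔽₃) = 1` for `88736f1 = [0,0,0,-1706296,-857886064]` (`a_3 = 3`). [cite: Cremona2006, Table 1 (Cremona label 88736f1)] -/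
theorem card_c88736f1_3 :
    Nat.card (((⟨0, 0, 0, -1706296, -857886064⟩ : WeierstrassCurve ℤ).map
      (Int.castRingHom (ZMod 3))).toAffine.Point) = 1 := by
  rw [@WeierstrassCurve.natCard_point_eq_one_add_card (ZMod 3) (@ZMod.instField 3 ⟨by norm_num⟩) _ _ _ (by decide +kernel),
    @card_sol_eq_sum_euler (ZMod 3) (@ZMod.instField 3 ⟨by norm_num⟩) _ _ (by rw [ZMod.ringChar_zmod_n]; decide), ZMod.card]
  decide +kernel

/-- `#Ẽ(𝔽₃) = 1` for `138592d1 = [0,0,0,16424,337520]` (`a_3 = 3`). [cite: Cremona2006, Table 1 (Cremona label 138592d1)] -/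
theorem card_c138592d1_3 :
    Nat.card (((⟨0, 0, 0, 16424, 337520⟩ : WeierstrassCurve ℤ).map
      (Int.castRingHom (ZMod 3))).toAffine.Point) = 1 := by
  rw [@WeierstrassCurve.natCard_point_eq_one_add_card (ZMod 3) (@ZMod.instField 3 ⟨by norm_num⟩) _ _ _ (by decide +kernel),
    @card_sol_eq_sum_euler (ZMod 3) (@ZMod.instField 3 ⟨by norm_num⟩) _ _ (by rw [ZMod.ringChar_zmod_n]; decide), ZMod.card]
  decide +kernel

/-- `#Ẽ(𝔽₃) = 1` for `261536h1 = [0,0,0,-11773,-401080]` (`a_3 = 3`). [cite: Cremona2006, Table 1 (Cremona label 261536h1)] -/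
theorem card_c261536h1_3 :
    Nat.card (((⟨0, 0, 0, -11773, -401080⟩ : WeierstrassCurve ℤ).map
      (Int.castRingHom (ZMod 3))).toAffine.Point) = 1 := by
  rw [@WeierstrassCurve.natCard_point_eq_one_add_card (ZMod 3) (@ZMod.instField 3 ⟨by norm_num⟩) _ _ _ (by decide +kernel),
    @card_sol_eq_sum_euler (ZMod 3) (@ZMod.instField 3 ⟨by norm_num⟩) _ _ (by rw [ZMod.ringChar_zmod_n]; decide), ZMod.card]
  decide +kernel

/-- `#Ẽ(𝔽₃) = 1` for `292192d1 = [0,0,0,-7576,2698640]` (`a_3 = 3`). [cite: Cremona2006, Table 1 (Cremona label 292192d1)] -/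
theorem card_c292192d1_3 :
    Nat.card (((⟨0, 0, 0, -7576, 2698640⟩ : WeierstrassCurve ℤ).map
      (Int.castRingHom (ZMod 3))).toAffine.Point) = 1 := by
  rw [@WeierstrassCurve.natCard_point_eq_one_add_card (ZMod 3) (@ZMod.instField 3 ⟨by norm_num⟩) _ _ _ (by decide +kernel),
    @card_sol_eq_sum_euler (ZMod 3) (@ZMod.instField 3 ⟨by norm_num⟩) _ _ (by rw [ZMod.ringChar_zmod_n]; decide), ZMod.card]
  decide +kernel

/-- `#Ẽ(𝔽₃) = 1` for `54464z1 = [0,0,0,-22174,-710158]` (`a_3 = 3`). [cite: Cremona2006, Table 1 (Cremona label 54464z1)] -/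
theorem card_c54464z1_3 :
    Nat.card (((⟨0, 0, 0, -22174, -710158⟩ : WeierstrassCurve ℤ).map
      (Int.castRingHom (ZMod 3))).toAffine.Point) = 1 := by
  rw [@WeierstrassCurve.natCard_point_eq_one_add_card (ZMod 3) (@ZMod.instField 3 ⟨by norm_num⟩) _ _ _ (by decide +kernel),
    @card_sol_eq_sum_euler (ZMod 3) (@ZMod.instField 3 ⟨by norm_num⟩) _ _ (by rw [ZMod.ringChar_zmod_n]; decide), ZMod.card]
  decide +kernel

/-- `#Ẽ(𝔽₃) = 1` for `92224p1 = [0,0,0,-49174,4266830]` (`a_3 = 3`). [cite: Cremona2006, Table 1 (Cremona label 92224p1)] -/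
theorem card_c92224p1_3 :
    Nat.card (((⟨0, 0, 0, -49174, 4266830⟩ : WeierstrassCurve ℤ).map
      (Int.castRingHom (ZMod 3))).toAffine.Point) = 1 := by
  rw [@WeierstrassCurve.natCard_point_eq_one_add_card (ZMod 3) (@ZMod.instField 3 ⟨by norm_num⟩) _ _ _ (by decide +kernel),
    @card_sol_eq_sum_euler (ZMod 3) (@ZMod.instField 3 ⟨by norm_num⟩) _ _ (by rw [ZMod.ringChar_zmod_n]; decide), ZMod.card]
  decide +kernel

/-- `#Ẽ(𝔽₃) = 1` for `423872bj1 = [0,0,0,-639364,-196782208]` (`a_3 = 3`). [cite: Cremona2006, Table 1 (Cremona label 423872bj1)] -/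
theorem card_c423872bj1_3 :
    Nat.card (((⟨0, 0, 0, -639364, -196782208⟩ : WeierstrassCurve ℤ).map
      (Int.castRingHom (ZMod 3))).toAffine.Point) = 1 := by
  rw [@WeierstrassCurve.natCard_point_eq_one_add_card (ZMod 3) (@ZMod.instField 3 ⟨by norm_num⟩) _ _ _ (by decide +kernel),
    @card_sol_eq_sum_euler (ZMod 3) (@ZMod.instField 3 ⟨by norm_num⟩) _ _ (by rw [ZMod.ringChar_zmod_n]; decide), ZMod.card]
  decide +kernel

/-- `#Ẽ(𝔽₃) = 1` for `460736bk1 = [0,0,0,26492,884864]` (`a_3 = 3`). [cite: Cremona2006, Table 1 (Cremona label 460736bk1)] -/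
theorem card_c460736bk1_3 :
    Nat.card (((⟨0, 0, 0, 26492, 884864⟩ : WeierstrassCurve ℤ).map
      (Int.castRingHom (ZMod 3))).toAffine.Point) = 1 := by
  rw [@WeierstrassCurve.natCard_point_eq_one_add_card (ZMod 3) (@ZMod.instField 3 ⟨by norm_num⟩) _ _ _ (by decide +kernel),
    @card_sol_eq_sum_euler (ZMod 3) (@ZMod.instField 3 ⟨by norm_num⟩) _ _ (by rw [ZMod.ringChar_zmod_n]; decide), ZMod.card]
  decide +kernel

/-! ### §4. The generic unit-case consumer and the nine records (each: `ClassX8` decided from the integer model, the kernel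
congruence `threeTorsionIso_c<label>`, the partner data of §2, the unit `L`-value line `hL1`; conclusion `BSDp W 3` MODULO `hCL`) -/

section Records

variable (hCL : CorpuzLei2025_sharpFlatMainConjecture_transfer_OPEN)
  (hPR : PollackRubin2004.mainTheorem_signedCharIdeal_eq_of_cm)
  (h5 : realPeriodRat_eq_unit_mul_plusPeriod) (h3 : realPeriodRat_eq_unit_mul_plusPeriod_three)
  (hmodE : exists_isNewformOf) (hmod : hasEntireLFunction_rat)
  (hGZK : rank_eq_analyticRank_of_analyticRank_le_one)
include hCL hPR h5 h3 hmodE hmod hGZK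

/-- **The unit case of the CM-congruence transfer on X8 (generic consumer, MODULO the OPEN binder).** `E = W` in corner
X8 at `3` (`a_3 = ±3`, any mod-3 image) of analytic rank `0`; a CM partner `E′ = W′` with good supersingular reduction at `3`
and `a_3(E′) = 0`, a `Γ_ℚ`-equivariant `E[3] ≃ E′[3]` (`hiso`), and ONE `L`-value line `L(E′,1)/Ω_{E′} = t` with `t ≠ 0`,
`ord₃ t = 0` (`hL1`/`ht0`/`htv`). Then `BSD(E,3)`: the partner's `μ`-node is the THEOREM `signedMuVanishing_of_lvalue_three`
(Kurihara's unit case through the period unit `h3`), and `X8.bsdp_of_cmPartner_of_transfer_OPEN_of_analyticRank_eq_zero`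
(modularity ⟶ newform, PROVED Sprung pair `thm112_exists_isSprungPair_holds`, both colours non-zero in rank `0`, the
transfer `hCL` ⟶ `(ξ) = (L♭)` with Kim's formula ⟶ `BSDp` via `bsdp_iff_span_eq_span_chromaticL_of_analyticRank_eq_zero`).
CONDITIONAL on `hCL` (Corpuz–Lei 2025, PRE); nothing asserted about any curve. [claim: CorpuzLei2025, status: under-review]
[cite: PollackRubin2004, Theorem (p. 448) = Thm. 7.3] [cite: Kurihara2002, Thm. 0.1] [cite: Sprung2012, Main Conjecture 7.21] -/
theorem X8.bsdp_of_unitCasePartner_of_transfer_OPEN (W W' : WeierstrassCurve ℚ) [W.IsElliptic] [W.IsGloballyMinimal]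
    [W'.IsElliptic] [W'.IsGloballyMinimal] (hX : ClassX8 W 3) (h0 : W.analyticRank = 0)
    (hcm' : W'.HasCM) (hss' : GoodSS W' 3) (hap' : W'.frobeniusTrace 3 = 0)
    (hiso : ∃ e : geomTorsion W (3 : ℤ) ≃+ geomTorsion W' (3 : ℤ),
      ∀ (σ : Field.absoluteGaloisGroup ℚ) (P : geomTorsion W (3 : ℤ)), e (σ • P) = σ • e P)
    {t : ℚ} (hL1 : W'.entireLFunction 1 / (W'.realPeriodRat : ℂ) = (t : ℂ)) (ht0 : t ≠ 0)
    (htv : padicValRat 3 t = 0) : BSDp W 3 :=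
  X8.bsdp_of_cmPartner_of_transfer_OPEN_of_analyticRank_eq_zero W W' 3 hCL hPR h5 h3 hmodE hmod hGZK hX h0 hcm' hss'
    hap' hiso (signedMuVanishing_of_lvalue_three h5 h3 hmodE W' hss' hap' hL1 ht0 htv)


/-- **`BSD(E,3)` for `46112f1` — UNIT CASE, partner `32a2 : y² = x³ − x`** (X8: `N = 46112 = 2⁵·11·131`, `a_3 = 3`, image
`3Nn`, rank `0`, `∏ c_ℓ = 36`, `#Ш_an = 1`; flag-free of record by 3-descent `bsdp3_nn46112f1`). Congruence = kernel theorem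
`threeTorsionIso_c46112f1` (direct pencil, `l₀ = 68/5`); per-pair data: `h0 : r_an(E) = 0` (Cremona) and `hL1 : L(E′,1)/Ω_{E′} = 1/8`
(table37, three engines, kit j251201) ⟹ `SignedMuVanishing E′ 3` is a theorem. MODULO the PRE binder `hCL` ALONE; PER PAIR; nothing
booked. [claim: CorpuzLei2025, status: under-review] [cite: PollackRubin2004, Theorem (p. 448) = Thm. 7.3] [cite: Kurihara2002, Thm. 0.1]
[cite: Fisher2012Hessian, Thm. 13.2 (n = 3)] [cite: Cremona2006, Table 1 (Cremona labels 46112f1, 32a2)] -/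
theorem X8.bsdp_c46112f1_of_cmPartner_of_transfer_OPEN
    (W : WeierstrassCurve ℚ) [W.IsElliptic] [W.IsGloballyMinimal] (hW : W = ⟨0, 0, 0, -196696, -34134640⟩)
    (W' : WeierstrassCurve ℚ) [W'.IsElliptic] [W'.IsGloballyMinimal] (hW' : W' = ⟨0, 0, 0, -1, 0⟩)
    (h0 : W.analyticRank = 0)
    (hL1 : W'.entireLFunction 1 / (W'.realPeriodRat : ℂ) = ((1 / 8 : ℚ) : ℂ)) : BSDp W 3 := by
  have hIW : integralModelInt W = ⟨0, 0, 0, -196696, -34134640⟩ :=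
    integralModelInt_eq_of_map_eq _ (by rw [hW]; ext <;> simp [WeierstrassCurve.map])
  have hX : ClassX8 W 3 := classX8_of_intModel hIW
    (by rw [intCurve_Δ 0 0 0 (-196696) (-34134640)]; decide +kernel) card_c46112f1_3 (Or.inl rfl)
  obtain ⟨hss', hap', hcm'⟩ := X8.partnerData_cm32a2 W' hW'
  subst hW; subst hW'
  exact X8.bsdp_of_unitCasePartner_of_transfer_OPEN hCL hPR h5 h3 hmodE hmod hGZK _ _ hX h0 hcm' hss' hap'
    threeTorsionIso_c46112f1 hL1 (by norm_num) padicValRat_three_one_div_eight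

/-- **`BSD(E,3)` for `88736f1` — UNIT CASE, partner `32a2 : y² = x³ − x`** (X8: `N = 88736 = 2⁵·47·59`, `a_3 = 3`, image
`3Nn`, rank `0`, `∏ c_ℓ = 18`, `#Ш_an = 1`; flag-free of record by 3-descent `bsdp3_nn88736f1`). Congruence = kernel theorem
`threeTorsionIso_c88736f1` (direct pencil, `l₀ = 124/7`); per-pair data: `h0 : r_an(E) = 0` (Cremona) and `hL1 : L(E′,1)/Ω_{E′} = 1/8`
(table37, three engines, kit j251201) ⟹ `SignedMuVanishing E′ 3` is a theorem. MODULO the PRE binder `hCL` ALONE; PER PAIR; nothing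
booked. [claim: CorpuzLei2025, status: under-review] [cite: PollackRubin2004, Theorem (p. 448) = Thm. 7.3] [cite: Kurihara2002, Thm. 0.1]
[cite: Fisher2012Hessian, Thm. 13.2 (n = 3)] [cite: Cremona2006, Table 1 (Cremona labels 88736f1, 32a2)] -/
theorem X8.bsdp_c88736f1_of_cmPartner_of_transfer_OPEN
    (W : WeierstrassCurve ℚ) [W.IsElliptic] [W.IsGloballyMinimal] (hW : W = ⟨0, 0, 0, -1706296, -857886064⟩)
    (W' : WeierstrassCurve ℚ) [W'.IsElliptic] [W'.IsGloballyMinimal] (hW' : W' = ⟨0, 0, 0, -1, 0⟩)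
    (h0 : W.analyticRank = 0)
    (hL1 : W'.entireLFunction 1 / (W'.realPeriodRat : ℂ) = ((1 / 8 : ℚ) : ℂ)) : BSDp W 3 := by
  have hIW : integralModelInt W = ⟨0, 0, 0, -1706296, -857886064⟩ :=
    integralModelInt_eq_of_map_eq _ (by rw [hW]; ext <;> simp [WeierstrassCurve.map])
  have hX : ClassX8 W 3 := classX8_of_intModel hIW
    (by rw [intCurve_Δ 0 0 0 (-1706296) (-857886064)]; decide +kernel) card_c88736f1_3 (Or.inl rfl)
  obtain ⟨hss', hap', hcm'⟩ := X8.partnerData_cm32a2 W' hW'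
  subst hW; subst hW'
  exact X8.bsdp_of_unitCasePartner_of_transfer_OPEN hCL hPR h5 h3 hmodE hmod hGZK _ _ hX h0 hcm' hss' hap'
    threeTorsionIso_c88736f1 hL1 (by norm_num) padicValRat_three_one_div_eight

/-- **`BSD(E,3)` for `138592d1` — UNIT CASE, partner `32a2 : y² = x³ − x`** (X8: `N = 138592 = 2⁵·61·71`, `a_3 = 3`, image
`3Nn`, rank `0`, `∏ c_ℓ = 18`, `#Ш_an = 1`; flag-free of record by 3-descent `bsdp3_nn138592d1`). Congruence = kernel theorem
`threeTorsionIso_c138592d1` (direct pencil, `l₀ = −4/5`); per-pair data: `h0 : r_an(E) = 0` (Cremona) and `hL1 : L(E′,1)/Ω_{E′} = 1/8`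
(table37, three engines, kit j251201) ⟹ `SignedMuVanishing E′ 3` is a theorem. MODULO the PRE binder `hCL` ALONE; PER PAIR; nothing
booked. [claim: CorpuzLei2025, status: under-review] [cite: PollackRubin2004, Theorem (p. 448) = Thm. 7.3] [cite: Kurihara2002, Thm. 0.1]
[cite: Fisher2012Hessian, Thm. 13.2 (n = 3)] [cite: Cremona2006, Table 1 (Cremona labels 138592d1, 32a2)] -/
theorem X8.bsdp_c138592d1_of_cmPartner_of_transfer_OPEN
    (W : WeierstrassCurve ℚ) [W.IsElliptic] [W.IsGloballyMinimal] (hW : W = ⟨0, 0, 0, 16424, 337520⟩)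
    (W' : WeierstrassCurve ℚ) [W'.IsElliptic] [W'.IsGloballyMinimal] (hW' : W' = ⟨0, 0, 0, -1, 0⟩)
    (h0 : W.analyticRank = 0)
    (hL1 : W'.entireLFunction 1 / (W'.realPeriodRat : ℂ) = ((1 / 8 : ℚ) : ℂ)) : BSDp W 3 := by
  have hIW : integralModelInt W = ⟨0, 0, 0, 16424, 337520⟩ :=
    integralModelInt_eq_of_map_eq _ (by rw [hW]; ext <;> simp [WeierstrassCurve.map])
  have hX : ClassX8 W 3 := classX8_of_intModel hIW
    (by rw [intCurve_Δ 0 0 0 (16424) (337520)]; decide +kernel) card_c138592d1_3 (Or.inl rfl)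
  obtain ⟨hss', hap', hcm'⟩ := X8.partnerData_cm32a2 W' hW'
  subst hW; subst hW'
  exact X8.bsdp_of_unitCasePartner_of_transfer_OPEN hCL hPR h5 h3 hmodE hmod hGZK _ _ hX h0 hcm' hss' hap'
    threeTorsionIso_c138592d1 hL1 (by norm_num) padicValRat_three_one_div_eight

/-- **`BSD(E,3)` for `261536h1` — UNIT CASE, partner `32a2 : y² = x³ − x`** (X8: `N = 261536 = 2⁵·11·743`, `a_3 = 3`, image
`3Nn`, rank `0`, `∏ c_ℓ = 18`, `#Ш_an = 1`; flag-free of record by 3-descent `bsdp3_nn261536h1`). Congruence = kernel theorem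
`threeTorsionIso_c261536h1` (direct pencil, `l₀ = 40`); per-pair data: `h0 : r_an(E) = 0` (Cremona) and `hL1 : L(E′,1)/Ω_{E′} = 1/8`
(table37, three engines, kit j251201) ⟹ `SignedMuVanishing E′ 3` is a theorem. MODULO the PRE binder `hCL` ALONE; PER PAIR; nothing
booked. [claim: CorpuzLei2025, status: under-review] [cite: PollackRubin2004, Theorem (p. 448) = Thm. 7.3] [cite: Kurihara2002, Thm. 0.1]
[cite: Fisher2012Hessian, Thm. 13.2 (n = 3)] [cite: Cremona2006, Table 1 (Cremona labels 261536h1, 32a2)] -/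
theorem X8.bsdp_c261536h1_of_cmPartner_of_transfer_OPEN
    (W : WeierstrassCurve ℚ) [W.IsElliptic] [W.IsGloballyMinimal] (hW : W = ⟨0, 0, 0, -11773, -401080⟩)
    (W' : WeierstrassCurve ℚ) [W'.IsElliptic] [W'.IsGloballyMinimal] (hW' : W' = ⟨0, 0, 0, -1, 0⟩)
    (h0 : W.analyticRank = 0)
    (hL1 : W'.entireLFunction 1 / (W'.realPeriodRat : ℂ) = ((1 / 8 : ℚ) : ℂ)) : BSDp W 3 := by
  have hIW : integralModelInt W = ⟨0, 0, 0, -11773, -401080⟩ :=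
    integralModelInt_eq_of_map_eq _ (by rw [hW]; ext <;> simp [WeierstrassCurve.map])
  have hX : ClassX8 W 3 := classX8_of_intModel hIW
    (by rw [intCurve_Δ 0 0 0 (-11773) (-401080)]; decide +kernel) card_c261536h1_3 (Or.inl rfl)
  obtain ⟨hss', hap', hcm'⟩ := X8.partnerData_cm32a2 W' hW'
  subst hW; subst hW'
  exact X8.bsdp_of_unitCasePartner_of_transfer_OPEN hCL hPR h5 h3 hmodE hmod hGZK _ _ hX h0 hcm' hss' hap'
    threeTorsionIso_c261536h1 hL1 (by norm_num) padicValRat_three_one_div_eight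

/-- **`BSD(E,3)` for `292192d1` — UNIT CASE, partner `32a2 : y² = x³ − x`** (X8: `N = 292192 = 2⁵·23·397`, `a_3 = 3`, image
`3Nn`, rank `0`, `∏ c_ℓ = 18`, `#Ш_an = 1`; flag-free of record by 3-descent `bsdp3_nn292192d1`). Congruence = kernel theorem
`threeTorsionIso_c292192d1` (direct pencil, `l₀ = −28/5`); per-pair data: `h0 : r_an(E) = 0` (Cremona) and `hL1 : L(E′,1)/Ω_{E′} = 1/8`
(table37, three engines, kit j251201) ⟹ `SignedMuVanishing E′ 3` is a theorem. MODULO the PRE binder `hCL` ALONE; PER PAIR; nothing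
booked. [claim: CorpuzLei2025, status: under-review] [cite: PollackRubin2004, Theorem (p. 448) = Thm. 7.3] [cite: Kurihara2002, Thm. 0.1]
[cite: Fisher2012Hessian, Thm. 13.2 (n = 3)] [cite: Cremona2006, Table 1 (Cremona labels 292192d1, 32a2)] -/
theorem X8.bsdp_c292192d1_of_cmPartner_of_transfer_OPEN
    (W : WeierstrassCurve ℚ) [W.IsElliptic] [W.IsGloballyMinimal] (hW : W = ⟨0, 0, 0, -7576, 2698640⟩)
    (W' : WeierstrassCurve ℚ) [W'.IsElliptic] [W'.IsGloballyMinimal] (hW' : W' = ⟨0, 0, 0, -1, 0⟩)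
    (h0 : W.analyticRank = 0)
    (hL1 : W'.entireLFunction 1 / (W'.realPeriodRat : ℂ) = ((1 / 8 : ℚ) : ℂ)) : BSDp W 3 := by
  have hIW : integralModelInt W = ⟨0, 0, 0, -7576, 2698640⟩ :=
    integralModelInt_eq_of_map_eq _ (by rw [hW]; ext <;> simp [WeierstrassCurve.map])
  have hX : ClassX8 W 3 := classX8_of_intModel hIW
    (by rw [intCurve_Δ 0 0 0 (-7576) (2698640)]; decide +kernel) card_c292192d1_3 (Or.inl rfl)
  obtain ⟨hss', hap', hcm'⟩ := X8.partnerData_cm32a2 W' hW'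
  subst hW; subst hW'
  exact X8.bsdp_of_unitCasePartner_of_transfer_OPEN hCL hPR h5 h3 hmodE hmod hGZK _ _ hX h0 hcm' hss' hap'
    threeTorsionIso_c292192d1 hL1 (by norm_num) padicValRat_three_one_div_eight

/-- **`BSD(E,3)` for `54464z1` — UNIT CASE, partner `64a4 : y² = x³ + x`** (X8: `N = 54464 = 2⁶·23·37`, `a_3 = 3`, image
`3Nn`, rank `0`, `∏ c_ℓ = 18`, `#Ш_an = 1`; flag-free of record by 3-descent `bsdp3_nn54464z1`). Congruence = kernel theorem
`threeTorsionIso_c54464z1` (dual pencil, `l₀ = −68`); per-pair data: `h0 : r_an(E) = 0` (Cremona) and `hL1 : L(E′,1)/Ω_{E′} = 1/4`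
(table37, three engines, kit j251201) ⟹ `SignedMuVanishing E′ 3` is a theorem. MODULO the PRE binder `hCL` ALONE; PER PAIR; nothing
booked. [claim: CorpuzLei2025, status: under-review] [cite: PollackRubin2004, Theorem (p. 448) = Thm. 7.3] [cite: Kurihara2002, Thm. 0.1]
[cite: Fisher2012Hessian, §13 (n = 3)] [cite: Cremona2006, Table 1 (Cremona labels 54464z1, 64a4)] -/
theorem X8.bsdp_c54464z1_of_cmPartner_of_transfer_OPEN
    (W : WeierstrassCurve ℚ) [W.IsElliptic] [W.IsGloballyMinimal] (hW : W = ⟨0, 0, 0, -22174, -710158⟩)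
    (W' : WeierstrassCurve ℚ) [W'.IsElliptic] [W'.IsGloballyMinimal] (hW' : W' = ⟨0, 0, 0, 1, 0⟩)
    (h0 : W.analyticRank = 0)
    (hL1 : W'.entireLFunction 1 / (W'.realPeriodRat : ℂ) = ((1 / 4 : ℚ) : ℂ)) : BSDp W 3 := by
  have hIW : integralModelInt W = ⟨0, 0, 0, -22174, -710158⟩ :=
    integralModelInt_eq_of_map_eq _ (by rw [hW]; ext <;> simp [WeierstrassCurve.map])
  have hX : ClassX8 W 3 := classX8_of_intModel hIW
    (by rw [intCurve_Δ 0 0 0 (-22174) (-710158)]; decide +kernel) card_c54464z1_3 (Or.inl rfl)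
  obtain ⟨hss', hap', hcm'⟩ := X8.partnerData_cm64a4 W' hW'
  subst hW; subst hW'
  exact X8.bsdp_of_unitCasePartner_of_transfer_OPEN hCL hPR h5 h3 hmodE hmod hGZK _ _ hX h0 hcm' hss' hap'
    threeTorsionIso_c54464z1 hL1 (by norm_num) padicValRat_three_one_div_four

/-- **`BSD(E,3)` for `92224p1` — UNIT CASE, partner `64a4 : y² = x³ + x`** (X8: `N = 92224 = 2⁶·11·131`, `a_3 = 3`, image
`3Nn`, rank `0`, `∏ c_ℓ = 18`, `#Ш_an = 1`; flag-free of record by 3-descent `bsdp3_nn92224p1`). Congruence = kernel theorem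
`threeTorsionIso_c92224p1` (dual pencil, `l₀ = 68/5`); per-pair data: `h0 : r_an(E) = 0` (Cremona) and `hL1 : L(E′,1)/Ω_{E′} = 1/4`
(table37, three engines, kit j251201) ⟹ `SignedMuVanishing E′ 3` is a theorem. MODULO the PRE binder `hCL` ALONE; PER PAIR; nothing
booked. [claim: CorpuzLei2025, status: under-review] [cite: PollackRubin2004, Theorem (p. 448) = Thm. 7.3] [cite: Kurihara2002, Thm. 0.1]
[cite: Fisher2012Hessian, §13 (n = 3)] [cite: Cremona2006, Table 1 (Cremona labels 92224p1, 64a4)] -/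
theorem X8.bsdp_c92224p1_of_cmPartner_of_transfer_OPEN
    (W : WeierstrassCurve ℚ) [W.IsElliptic] [W.IsGloballyMinimal] (hW : W = ⟨0, 0, 0, -49174, 4266830⟩)
    (W' : WeierstrassCurve ℚ) [W'.IsElliptic] [W'.IsGloballyMinimal] (hW' : W' = ⟨0, 0, 0, 1, 0⟩)
    (h0 : W.analyticRank = 0)
    (hL1 : W'.entireLFunction 1 / (W'.realPeriodRat : ℂ) = ((1 / 4 : ℚ) : ℂ)) : BSDp W 3 := by
  have hIW : integralModelInt W = ⟨0, 0, 0, -49174, 4266830⟩ :=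
    integralModelInt_eq_of_map_eq _ (by rw [hW]; ext <;> simp [WeierstrassCurve.map])
  have hX : ClassX8 W 3 := classX8_of_intModel hIW
    (by rw [intCurve_Δ 0 0 0 (-49174) (4266830)]; decide +kernel) card_c92224p1_3 (Or.inl rfl)
  obtain ⟨hss', hap', hcm'⟩ := X8.partnerData_cm64a4 W' hW'
  subst hW; subst hW'
  exact X8.bsdp_of_unitCasePartner_of_transfer_OPEN hCL hPR h5 h3 hmodE hmod hGZK _ _ hX h0 hcm' hss' hap'
    threeTorsionIso_c92224p1 hL1 (by norm_num) padicValRat_three_one_div_four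

/-- **`BSD(E,3)` for `423872bj1` — UNIT CASE, partner `64a4 : y² = x³ + x`** (X8: `N = 423872 = 2⁶·37·179`, `a_3 = 3`, image
`3Nn`, rank `0`, `∏ c_ℓ = 36`, `#Ш_an = 4`; flag-free of record by 3-descent `bsdp3_nn423872bj1`). Congruence = kernel theorem
`threeTorsionIso_c423872bj1` (dual pencil, `l₀ = −17`); per-pair data: `h0 : r_an(E) = 0` (Cremona) and `hL1 : L(E′,1)/Ω_{E′} = 1/4`
(table37, three engines, kit j251201) ⟹ `SignedMuVanishing E′ 3` is a theorem. MODULO the PRE binder `hCL` ALONE; PER PAIR; nothing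
booked. [claim: CorpuzLei2025, status: under-review] [cite: PollackRubin2004, Theorem (p. 448) = Thm. 7.3] [cite: Kurihara2002, Thm. 0.1]
[cite: Fisher2012Hessian, §13 (n = 3)] [cite: Cremona2006, Table 1 (Cremona labels 423872bj1, 64a4)] -/
theorem X8.bsdp_c423872bj1_of_cmPartner_of_transfer_OPEN
    (W : WeierstrassCurve ℚ) [W.IsElliptic] [W.IsGloballyMinimal] (hW : W = ⟨0, 0, 0, -639364, -196782208⟩)
    (W' : WeierstrassCurve ℚ) [W'.IsElliptic] [W'.IsGloballyMinimal] (hW' : W' = ⟨0, 0, 0, 1, 0⟩)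
    (h0 : W.analyticRank = 0)
    (hL1 : W'.entireLFunction 1 / (W'.realPeriodRat : ℂ) = ((1 / 4 : ℚ) : ℂ)) : BSDp W 3 := by
  have hIW : integralModelInt W = ⟨0, 0, 0, -639364, -196782208⟩ :=
    integralModelInt_eq_of_map_eq _ (by rw [hW]; ext <;> simp [WeierstrassCurve.map])
  have hX : ClassX8 W 3 := classX8_of_intModel hIW
    (by rw [intCurve_Δ 0 0 0 (-639364) (-196782208)]; decide +kernel) card_c423872bj1_3 (Or.inl rfl)
  obtain ⟨hss', hap', hcm'⟩ := X8.partnerData_cm64a4 W' hW'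
  subst hW; subst hW'
  exact X8.bsdp_of_unitCasePartner_of_transfer_OPEN hCL hPR h5 h3 hmodE hmod hGZK _ _ hX h0 hcm' hss' hap'
    threeTorsionIso_c423872bj1 hL1 (by norm_num) padicValRat_three_one_div_four

/-- **`BSD(E,3)` for `460736bk1` — UNIT CASE, partner `64a4 : y² = x³ + x`** (X8: `N = 460736 = 2⁶·23·313`, `a_3 = 3`, image
`3Nn`, rank `0`, `∏ c_ℓ = 36`, `#Ш_an = 1`; flag-free of record by 3-descent `bsdp3_nn460736bk1`). Congruence = kernel theorem
`threeTorsionIso_c460736bk1` (dual pencil, `l₀ = 1`); per-pair data: `h0 : r_an(E) = 0` (Cremona) and `hL1 : L(E′,1)/Ω_{E′} = 1/4`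
(table37, three engines, kit j251201) ⟹ `SignedMuVanishing E′ 3` is a theorem. MODULO the PRE binder `hCL` ALONE; PER PAIR; nothing
booked. [claim: CorpuzLei2025, status: under-review] [cite: PollackRubin2004, Theorem (p. 448) = Thm. 7.3] [cite: Kurihara2002, Thm. 0.1]
[cite: Fisher2012Hessian, §13 (n = 3)] [cite: Cremona2006, Table 1 (Cremona labels 460736bk1, 64a4)] -/
theorem X8.bsdp_c460736bk1_of_cmPartner_of_transfer_OPEN
    (W : WeierstrassCurve ℚ) [W.IsElliptic] [W.IsGloballyMinimal] (hW : W = ⟨0, 0, 0, 26492, 884864⟩)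
    (W' : WeierstrassCurve ℚ) [W'.IsElliptic] [W'.IsGloballyMinimal] (hW' : W' = ⟨0, 0, 0, 1, 0⟩)
    (h0 : W.analyticRank = 0)
    (hL1 : W'.entireLFunction 1 / (W'.realPeriodRat : ℂ) = ((1 / 4 : ℚ) : ℂ)) : BSDp W 3 := by
  have hIW : integralModelInt W = ⟨0, 0, 0, 26492, 884864⟩ :=
    integralModelInt_eq_of_map_eq _ (by rw [hW]; ext <;> simp [WeierstrassCurve.map])
  have hX : ClassX8 W 3 := classX8_of_intModel hIW
    (by rw [intCurve_Δ 0 0 0 (26492) (884864)]; decide +kernel) card_c460736bk1_3 (Or.inl rfl)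
  obtain ⟨hss', hap', hcm'⟩ := X8.partnerData_cm64a4 W' hW'
  subst hW; subst hW'
  exact X8.bsdp_of_unitCasePartner_of_transfer_OPEN hCL hPR h5 h3 hmodE hmod hGZK _ _ hX h0 hcm' hss' hap'
    threeTorsionIso_c460736bk1 hL1 (by norm_num) padicValRat_three_one_div_four

end Records

end Summit.BirchSwinnertonDyer.BirchSwinnertonDyer.Theorems

end
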